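import Mathlib
import Literature.AlgebraicGeometry.Resolution.WeightedResolutionDatum
import Summits.ResolutionOfSingularities.ResolutionOfSingularities.Theorems.WeightedInvariantRegularSubschemeCentre

/-!
# Weight-scaling twins of a presented weighted centre

[OURS · L1 W4.3 · chain w43, seat tri-2 (TRIAGE §v6 O-v6.2)] Negative helper lemmas for crux `WeightedConstruction`
(stmt-ResolutionOfSingularities-0571), bearing on idea-2's ROUND-5 typing `Sketch-R5.lean` (`PresentedCentre`,
`filtration m = weightedMonomialIdeal u w m`, `level f = sSup {m | f ∈ filtration m}`, `profile = sorted (level / wᵢ)`,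
clause (U) `CertifiedUniqueness`: "two maximal certified moves have the same filtration").  NOT a statement of any
manuscript; no Hironaka statement is used as a premise; pure commutative algebra over the tree's
`Literature.AlgebraicGeometry.Resolution.weightedMonomialIdeal u w n = (u^α : Σ wᵢ αᵢ ≥ n)`.

THE TWINS.  Multiplying every weight by `d ≥ 1` re-indexes the monomial filtration by the ceiling,
`J^{(d·w)}_n = J^{(w)}_{⌈n/d⌉}` (`weightedMonomialIdeal_mul_weights`), so `J^{(d·w)}_{d n} = J^{(w)}_n`
(`weightedMonomialIdeal_mul_weights_mul`) and the level of every `f` with bounded level scales by `d`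
(`sSup_setOf_mem_mul_weights`): the presented centres `(u; w)` and `(u; d·w)` have the same centre, the same
admissibility, and the SAME PROFILE `(d·ℓ)/(d·wᵢ) = ℓ/wᵢ`, but DIFFERENT ℕ-indexed filtrations — already for
`w = (1,…,1)`, `d = 2` at index `2`: `J^{(2,…,2)}_2 = 𝔪 ≠ 𝔪² = J^{(1,…,1)}_2` whenever `u` generates `𝔪 ≠ ⊥`
(`weightedMonomialIdeal_const_two_two_ne_const_one_two`, Nakayama).  Hence an equality-of-filtrations
uniqueness clause can only hold up to re-indexing / for PRIMITIVE weight vectors (gcd of the positive weights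
`= 1`, the "reduced centre" of Abramovich–Quek–Schober) — the repair (U′) of TRIAGE §v6; that both twins are
maximal certified at the node `xy` ((x,y;1,1) vs (x,y;2,2)) and at the cusp `x²+y³` ((3,2) vs (6,4)) is the
by-hand part of O-v6.2 (no singular successor; `v* = (2,2)`, resp. `(2,3)`), not formalised here.
AI-written; weaker than expert review.
-/

open IsLocalRing
open Literature.AlgebraicGeometry.Resolution

set_option linter.dupNamespace false
set_option autoImplicit false

namespace Summit.ResolutionOfSingularities.ResolutionOfSingularities.Theorems.WeightedConstruction.Negative.WeightScalingTwins

/-- Ceiling division against a multiple: `⌈n/d⌉ ≤ s ↔ n ≤ d·s` (`⌈n/d⌉ = (n + d - 1) / d`). [folklore] -/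
theorem add_pred_div_le_iff {n d s : ℕ} (hd : 0 < d) : (n + d - 1) / d ≤ s ↔ n ≤ d * s := by
  rw [Nat.div_le_iff_le_mul_add_pred hd]
  generalize d * s = t
  omega

section Scaling

variable {A : Type*} [CommRing A] {m : ℕ}

/-- **Scaling all weights by `d ≥ 1` re-indexes the monomial filtration by the ceiling**:
`(u^α : Σ d wᵢ αᵢ ≥ n) = (u^α : Σ wᵢ αᵢ ≥ ⌈n/d⌉)`. [folklore] -/
theorem weightedMonomialIdeal_mul_weights (u : Fin m → A) (w : Fin m → ℕ) {d : ℕ} (hd : 0 < d) (n : ℕ) :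
    weightedMonomialIdeal u (fun i => d * w i) n = weightedMonomialIdeal u w ((n + d - 1) / d) := by
  have key : ∀ α : Fin m → ℕ, (n ≤ ∑ i, (d * w i) * α i) ↔ ((n + d - 1) / d ≤ ∑ i, w i * α i) := by
    intro α
    rw [add_pred_div_le_iff hd, Finset.mul_sum]
    simp only [mul_assoc]
  unfold weightedMonomialIdeal
  congr 1
  ext x
  constructor
  · rintro ⟨α, hα, rfl⟩
    exact ⟨α, (key α).mp hα, rfl⟩
  · rintro ⟨α, hα, rfl⟩
    exact ⟨α, (key α).mpr hα, rfl⟩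

/-- **The `d`-fold twin at index `d·n` is the original piece**: `J^{(d·w)}_{d n} = J^{(w)}_n`. [folklore] -/
theorem weightedMonomialIdeal_mul_weights_mul (u : Fin m → A) (w : Fin m → ℕ) {d : ℕ} (hd : 0 < d) (n : ℕ) :
    weightedMonomialIdeal u (fun i => d * w i) (d * n) = weightedMonomialIdeal u w n := by
  rw [weightedMonomialIdeal_mul_weights u w hd]
  have h : (d * n + d - 1) / d = n := by
    rw [show d * n + d - 1 = (d - 1) + d * n by omega, Nat.add_mul_div_left _ _ hd,
      Nat.div_eq_of_lt (by omega : d - 1 < d), zero_add]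
  rw [h]

/-- **Levels scale by `d`**: if the set of indices `n` with `f ∈ J^{(w)}_n` is bounded (e.g. `f ≠ 0` in a
Noetherian local ring with the `uᵢ` non-units), then `sup {n | f ∈ J^{(d·w)}_n} = d · sup {n | f ∈ J^{(w)}_n}`;
so the twins `(u; w)` and `(u; d·w)` have the same profile `level / wᵢ`. [folklore] -/
theorem sSup_setOf_mem_mul_weights (u : Fin m → A) (w : Fin m → ℕ) {d : ℕ} (hd : 0 < d) (f : A)
    (hB : BddAbove {n : ℕ | f ∈ weightedMonomialIdeal u w n}) :
    sSup {n : ℕ | f ∈ weightedMonomialIdeal u (fun i => d * w i) n} =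
      d * sSup {n : ℕ | f ∈ weightedMonomialIdeal u w n} := by
  set T : Set ℕ := {n : ℕ | f ∈ weightedMonomialIdeal u w n} with hT
  have h0 : (0 : ℕ) ∈ T := by
    show f ∈ weightedMonomialIdeal u w 0
    rw [weightedMonomialIdeal_zero]
    exact Submodule.mem_top
  have hL : sSup T ∈ T := Nat.sSup_mem ⟨0, h0⟩ hB
  have hmem : ∀ n, n ∈ T ↔ n ≤ sSup T := fun n =>
    ⟨fun hn => le_csSup hB hn, fun hn => weightedMonomialIdeal_antitone u w hn hL⟩
  have hset : {n : ℕ | f ∈ weightedMonomialIdeal u (fun i => d * w i) n} = Set.Iic (d * sSup T) := by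
    ext n
    rw [Set.mem_setOf_eq, Set.mem_Iic, weightedMonomialIdeal_mul_weights u w hd,
      show (f ∈ weightedMonomialIdeal u w ((n + d - 1) / d)) = ((n + d - 1) / d ∈ T) from rfl, hmem,
      add_pred_div_le_iff hd]
  rw [hset, csSup_Iic]

end Scaling

section Twins

variable {S : Type*} [CommRing S] [IsLocalRing S] [IsNoetherianRing S] {m : ℕ}

/-- **The weight-doubling twin has a different filtration.** If `u` generates the maximal ideal `𝔪 ≠ ⊥`
of a Noetherian local ring, then `J^{(2,…,2)}_2 = 𝔪 ≠ 𝔪² = J^{(1,…,1)}_2` (Nakayama: `𝔪 = 𝔪²` forces `𝔪 = ⊥`).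
So "two presented centres with the same profile have the same filtration" fails for the twins
`(u; 1,…,1)` / `(u; 2,…,2)` as soon as both are maximal certified (node, cusp: TRIAGE §v6 O-v6.2). [folklore] -/
theorem weightedMonomialIdeal_const_two_two_ne_const_one_two (u : Fin m → S)
    (hu : Ideal.span (Set.range u) = maximalIdeal S) (hS : maximalIdeal S ≠ ⊥) :
    weightedMonomialIdeal u (fun _ => 2) 2 ≠ weightedMonomialIdeal u (fun _ => 1) 2 := by
  intro h
  have h2 : weightedMonomialIdeal u (fun _ => (2 : ℕ)) 2 = maximalIdeal S := by
    have h' := weightedMonomialIdeal_mul_weights_mul u (fun _ => (1 : ℕ)) (d := 2) two_pos 1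
    simp only [mul_one] at h'
    rw [h', Theorems.weightedMonomialIdeal_one_eq_pow, pow_one, hu]
  have h1 : weightedMonomialIdeal u (fun _ => (1 : ℕ)) 2 = maximalIdeal S ^ 2 := by
    rw [Theorems.weightedMonomialIdeal_one_eq_pow, hu]
  rw [h2, h1] at h
  apply hS
  refine Submodule.eq_bot_of_le_smul_of_le_jacobson_bot (maximalIdeal S) (maximalIdeal S)
    (IsNoetherian.noetherian _) ?_ ?_
  · rw [smul_eq_mul, ← pow_two, ← h]
  · rw [IsLocalRing.jacobson_eq_maximalIdeal ⊥ bot_ne_top]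

/-- The same for every scaling factor `d ≥ 2` at index `d`: `J^{(d,…,d)}_d = 𝔪 ≠ 𝔪^d = J^{(1,…,1)}_d`. [folklore] -/
theorem weightedMonomialIdeal_const_ne_const_one (u : Fin m → S)
    (hu : Ideal.span (Set.range u) = maximalIdeal S) (hS : maximalIdeal S ≠ ⊥) {d : ℕ} (hd : 2 ≤ d) :
    weightedMonomialIdeal u (fun _ => d) d ≠ weightedMonomialIdeal u (fun _ => 1) d := by
  intro h
  have hd0 : 0 < d := by omega
  have h2 : weightedMonomialIdeal u (fun _ => d) d = maximalIdeal S := by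
    have h' := weightedMonomialIdeal_mul_weights_mul u (fun _ => (1 : ℕ)) hd0 1
    simp only [mul_one] at h'
    rw [h', Theorems.weightedMonomialIdeal_one_eq_pow, pow_one, hu]
  have h1 : weightedMonomialIdeal u (fun _ => (1 : ℕ)) d = maximalIdeal S ^ d := by
    rw [Theorems.weightedMonomialIdeal_one_eq_pow, hu]
  rw [h2, h1] at h
  -- `𝔪 = 𝔪^d ≤ 𝔪²` for `d ≥ 2`, so `𝔪 ≤ 𝔪 • 𝔪` and Nakayama gives `𝔪 = ⊥`
  apply hS
  refine Submodule.eq_bot_of_le_smul_of_le_jacobson_bot (maximalIdeal S) (maximalIdeal S)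
    (IsNoetherian.noetherian _) ?_ ?_
  · rw [smul_eq_mul, ← pow_two]
    calc maximalIdeal S = maximalIdeal S ^ d := h
      _ ≤ maximalIdeal S ^ 2 := Ideal.pow_le_pow_right hd
  · rw [IsLocalRing.jacobson_eq_maximalIdeal ⊥ bot_ne_top]

end Twins

end Summit.ResolutionOfSingularities.ResolutionOfSingularities.Theorems.WeightedConstruction.Negative.WeightScalingTwins
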